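import Summits.QuantumFields.QCD.Theses.GapBuysCauchyRate
import Literature.MathematicalPhysics.QuantumFieldTheory.GaugeCovariantBlockMap
import Summits.QuantumFields.QCD.Theorems.QuarksAsStableActionStableActionBridgeDefs

/-!
# Stub `stub_schwingerMultilinear` of line `birth` for crux `GapBuysCauchyRate.LadderCauchyRate`
(item stmt-QuantumFields-17307, route route-QuantumFields-GapBuysCauchyRate, sub-problem QCD)

What is proved: the general SPECIES MULTILINEARITY (W1) of the lattice QCD `n`-point functions
`qcdLatticeSchwinger` of a regularised scheme: for every arity `n`, species string `σ` and real test
functions `fᵢ`,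
  `S_n(reg.scheme m z shift; σ, f) = (∏ᵢ z_{σᵢ}(k)) · S_n(reg.scheme m 1 shift; σ, f)`,
i.e. the `n`-point function of `reg.scheme m z shift` is `∏ᵢ z_{σᵢ}(k)` times that of the `z ≡ 1`
scheme with the same additive shifts (the smeared field `Φ_k^s(f) = z_s(k) a_k⁴ Σ_x f(a_k x) (O_s(x) − shift_s(k))`
carries the factor `z_s(k)` and the torus functional is linear).

How: for `n ≥ 1` the landed bookkeeping of `Theorems/QuarksAsStableActionStableActionBridgeDefs`
(`qcdLatticeSchwinger_eq_qcdLatticeDist`, `qcdLatticeDist_apply` on the canonical tensor witness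
`SchwartzMap.tensorFin`, `prod_ofFn_smul`) writes the `n`-point function of `reg.scheme m zz shift` as the
finite sum over site tuples of `(∏ᵢ zz_{σᵢ}(k) a_k⁴) · ⟨∏ᵢ (O_{σᵢ}(xᵢ) − shift_{σᵢ}(k))⟩ · ∏ᵢ fᵢ(a_k xᵢ)`
with a `zz`-free torus expectation (`schwingerSchemeClosedForm`, the closed form of the landed E1 file
`…StubSpeciesMultilinear`); the claim is then the termwise identity `∏ᵢ (zᵢ a⁴) = (∏ᵢ zᵢ) ∏ᵢ (1 · a⁴)`
(`Finset.prod_mul_distrib`).  For `n = 0` both sides are the normalisation quotient of the torus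
functional (empty ordered product, empty `∏`), and the two schemes have the same gauge measure, torus
side and bare masses.  Sources: Montvay–Münster 1994 §5.1 (composite fields, multiplicative
renormalisation); Glimm–Jaffe 1987 §6.1.  Everything is proved.

Pure theorem file (no definitions): the registered stub signature, proved in tree vocabulary.
-/

noncomputable section

namespace Summit.QuantumFields.QCD.Cruxes.LadderCauchyRate.Birth

open scoped BigOperators Topology Classical
open MeasureTheory Filter
open Literature.MathematicalPhysics.AQFT Literature.Probability.LatticeModels
  Literature.MathematicalPhysics.QuantumLattice Literature.MathematicalPhysics.QuantumFieldTheory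
open Summit.QuantumFields.QCD.Theses.GapBuysCauchyRate

open Summit.QuantumFields.QCD.Cruxes.StableActionBridge.Sketch in
/-- **The species renormalisations factor out of the torus moments**:
`W_σ(x) = (∏ᵢ z_{σᵢ}(k) a_k⁴) · ⟨∏ᵢ (O_{σᵢ}(xᵢ) − shift_{σᵢ}(k))⟩_{β_k, 2L_k+1, m(k)}` (ordered product;
`prod_ofFn_smul`, linearity of the Berezin and Bochner integrals).  (Copy of the private lemma
`qcdTorusMomentStr_factor` of the landed E1 file.) -/
private theorem torusMomentStr_zFactor {Nf : ℕ} (sch : QCDScheme Nf) (k : ℕ) {n : ℕ}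
    (σ : Fin n → QCDField Nf) (x : Fin n → _root_.Literature.Probability.LatticeModels.Site 4) :
    qcdTorusMomentStr sch k σ x =
      (∏ i, ((sch.z (σ i) k * sch.a k ^ 4 : ℝ) : ℂ)) *
        qcdTorusExpect (sch.β k) (sch.side k) (fun fl => sch.mq fl k)
          (fun U => (List.ofFn fun i => (insertion U (σ i) (x i) -
            algebraMap ℂ _ ((sch.shift (σ i) k : ℝ) : ℂ))).prod) := by
  unfold qcdTorusMomentStr qcdTorusExpect qcdGaugeMeasure
  simp only [renormInsertion, prod_ofFn_smul, smul_mul_assoc, map_smul, smul_eq_mul,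
    integral_const_mul]
  rw [mul_div_assoc]

open Summit.QuantumFields.QCD.Cruxes.StableActionBridge.Sketch in
/-- **Closed form of the `n`-point functions of a regularised scheme** (`n ≥ 1`): for
`reg.scheme m zz shift`, `⟨∏ᵢ Φ^{σᵢ}(fᵢ)⟩ = Σ_{x ∈ boxⁿ} (∏ᵢ zz_{σᵢ}(k) a_k⁴) ⟨∏ᵢ (O_{σᵢ}(xᵢ) − shift_{σᵢ}(k))⟩ ∏ᵢ fᵢ(a_k xᵢ)`
on the torus of side `2 L_k + 1` at `β_k` and the bare masses of `reg` (which do not depend on `zz`,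
`shift`); the whole `zz`-dependence is the explicit prefactor.  (Copy of the private lemma
`schwinger_scheme_eq` of the landed E1 file.) -/
private theorem schwingerSchemeClosedForm {Nf : ℕ} (reg : QCDRegularisation Nf) (m : Fin Nf → ℝ)
    (zz shift : QCDField Nf → ℕ → ℝ) (k n : ℕ) (hn : n ≠ 0) (σ : Fin n → QCDField Nf)
    (f : Fin n → SchwartzMap (EuclideanSpace ℝ (Fin 4)) ℝ) :
    qcdLatticeSchwinger (reg.scheme m zz shift) k n σ f =
      ∑ x ∈ Fintype.piFinset (fun _ : Fin n => Literature.Probability.LatticeModels.box 4 (reg.L k)),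
        ((∏ i, ((zz (σ i) k * reg.a k ^ 4 : ℝ) : ℂ)) *
          qcdTorusExpect (reg.β k) (2 * reg.L k + 1) (fun fl => (reg.scheme m 0 0).mq fl k)
            (fun U => (List.ofFn fun i => (insertion U (σ i) (x i) -
              algebraMap ℂ _ ((shift (σ i) k : ℝ) : ℂ))).prod)) *
        ∏ i, ((f i (reg.a k • siteToE (x i)) : ℝ) : ℂ) := by
  rw [← qcdLatticeSchwinger_eq_qcdLatticeDist _ k n hn σ f _ (isTensorOf_tensorFin _),
    qcdLatticeDist_apply _ k hn]
  refine Finset.sum_congr rfl fun x _ => ?_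
  rw [SchwartzMap.tensorFin_apply, torusMomentStr_zFactor]
  rfl

/-- **Degree `0`**: the `0`-point function of `reg.scheme m zz shift` is the normalisation quotient
`⟨1⟩` of the torus functional at `β_k`, side `2 L_k + 1` and the bare masses of `reg`; it does not
depend on the species renormalisations `(zz, shift)`. -/
private theorem schwingerSchemeZero {Nf : ℕ} (reg : QCDRegularisation Nf) (m : Fin Nf → ℝ)
    (zz shift : QCDField Nf → ℕ → ℝ) (k : ℕ) (σ : Fin 0 → QCDField Nf)
    (f : Fin 0 → SchwartzMap (EuclideanSpace ℝ (Fin 4)) ℝ) :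
    qcdLatticeSchwinger (reg.scheme m zz shift) k 0 σ f =
      qcdTorusExpect (reg.β k) (2 * reg.L k + 1) (fun fl => (reg.scheme m 0 0).mq fl k) (fun _ => 1) := by
  unfold qcdLatticeSchwinger qcdTorusExpect
  simp only [List.ofFn_zero, List.prod_nil]
  rfl

/-- (W1) **general species multilinearity** of the lattice `n`-point functions (size M, provable now:
the `qcdLatticeDist` bookkeeping of `Theorems/QuarksAsStableActionStableActionBridgeDefs`,
`prod_ofFn_smul`, `Finset.prod_mul_distrib`).  Registered signature = `SchwingerMultilinearStmt`
written out: `S_n(reg.scheme m z shift) = (∏ᵢ z_{σᵢ}(k)) · S_n(reg.scheme m 1 shift)`. -/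
theorem stub_schwingerMultilinear :
    ∀ (Nf : ℕ) (reg : QCDRegularisation Nf) (m : Fin Nf → ℝ) (z shift : QCDField Nf → ℕ → ℝ) (k n : ℕ)
      (σ : Fin n → QCDField Nf) (f : Fin n → SchwartzMap (EuclideanSpace ℝ (Fin 4)) ℝ),
      qcdLatticeSchwinger (reg.scheme m z shift) k n σ f =
        (∏ i, ((z (σ i) k : ℝ) : ℂ)) *
          qcdLatticeSchwinger (reg.scheme m (fun _ _ => (1 : ℝ)) shift) k n σ f := by
  intro Nf reg m z shift k n σ f
  rcases eq_or_ne n 0 with rfl | hn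
  · rw [schwingerSchemeZero, schwingerSchemeZero, Finset.univ_eq_empty, Finset.prod_empty, one_mul]
  · have hprod : (∏ i, ((z (σ i) k * reg.a k ^ 4 : ℝ) : ℂ)) =
        (∏ i, ((z (σ i) k : ℝ) : ℂ)) * ∏ i, (((fun _ _ => (1 : ℝ)) (σ i) k * reg.a k ^ 4 : ℝ) : ℂ) := by
      rw [← Finset.prod_mul_distrib]
      refine Finset.prod_congr rfl fun i _ => ?_
      push_cast
      ring
    rw [schwingerSchemeClosedForm reg m z shift k n hn, schwingerSchemeClosedForm reg m _ shift k n hn,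
      Finset.mul_sum]
    refine Finset.sum_congr rfl fun x _ => ?_
    rw [hprod]
    ring

end Summit.QuantumFields.QCD.Cruxes.LadderCauchyRate.Birth

end
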